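import Mathlib.AlgebraicGeometry.IdealSheaf.Basic
import Mathlib.RingTheory.Ideal.Quotient.Operations
import Mathlib.Algebra.Order.Kleene
import HarnessLib

/-!
# Crux `PatchingRelPerfect` (stmt-ResolutionOfSingularities-16161), chain W5.2 — F7(β) (β-AX) C-I, (M2b-T): THE END LIFT LEMMA

[OURS · L1 W5.2 · F7(β) (β-AX) X3 C-I (res-L1-w52-tri-2 FINDING 20:34:14Z (3), `CONTACT-DICTIONARY.md` v1.2 §7.5 «END LIFT LEMMA»;
res-L1-w52-plan-1 g12 G12-47 HANDS (ii))] Fact-free; def-free; pure algebra; NOT statements of the manuscript under review (Hironaka 2017);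
AI-written, weaker than expert review.

After the F-60 cure the total transform of the residual ideal reads `K^{tot} = (e·v) + Σⱼ (Fⱼ) + 𝓜(μ)` with `Fⱼ ∈ (Nⱼ)` and the invariant
`e ∣ Nⱼ`; on the carrier `G = V(v)` the generators have the END shape `Fⱼ|_G = N̄ⱼ·ḡⱼ`.  The lemma: for ANY lifts `gⱼ` of the `ḡⱼ`,
`K^{tot} = (e·v) ⊔ ⨆ⱼ (Nⱼ·gⱼ) ⊔ 𝓜(μ)` — congruent generators modulo the carrier may be exchanged under the multiplier `Nⱼ ≤ (e)`, because the
error `Nⱼ·(fⱼ − gⱼ) ∈ Nⱼ·(v) ⊆ (e·v)` is already in the ideal.  No strict transform of an `X`-level contact hypersurface is needed.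

* §1 `sup_mul_congr_mod` / `sup_finsetSup_mul_congr_mod` / `sup_listSup_mul_congr_mod` — the exchange law in ANY idempotent commutative semiring
  (ideals of a ring, ideal sheaves of a scheme): `N ≤ E`, `F ⊔ V = G ⊔ V` ⇒ `E·V ⊔ N·F ⊔ M = E·V ⊔ N·G ⊔ M` (one `j`, a `Finset`, a `List`).
* §2 elements of a commutative ring: `sub_mem_span_singleton_of_mul_sub_mem` (cancel a multiplier that is a non-zero-divisor modulo `v`:
  `N·(f − g) ∈ (v) ⇒ f − g ∈ (v)` — reading `Fⱼ|_G = N̄ⱼ ḡⱼ` in the domain `𝒪_G`), `mul_sub_mul_mem_span_mul` (`f − g ∈ (v)`, `e ∣ N` ⇒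
  `N f − N g ∈ (e v)`), `span_sup_span_mul_congr_mod` (the stalk form of the lemma).
* §3 `Scheme.IdealSheafData` forms (the patch form): `idealSheaf_sup_mul_congr_mod`, `idealSheaf_sup_finsetSup_mul_congr_mod`.

## References
* J. Kollár, *Lectures on Resolution of Singularities* (2007), (3.111) Step 3 (monomial bookkeeping). [Kollar2007]
* V. Cossart, U. Jannsen, S. Saito, LNM 2270 (2020), (6.2). [CossartJannsenSaito2020]
-/

-- `Summit.<Summit>.<Sub>.Theorems` with `Sub = Summit` (single-conjunct summit, D-0017)
set_option linter.dupNamespace false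

noncomputable section

open AlgebraicGeometry

namespace Summit.ResolutionOfSingularities.ResolutionOfSingularities.Theorems

universe u

namespace ContactEndLift

/-! ## §1 The exchange law in an idempotent commutative semiring -/

section Semiring

variable {R : Type*} [IdemCommSemiring R]

/-- **END LIFT, lattice form**: `N ≤ E` and `F ⊔ V = G ⊔ V` give `E·V ⊔ N·F ⊔ M = E·V ⊔ N·G ⊔ M`
(`N·F ≤ N·(G ⊔ V) = N·G ⊔ N·V ≤ N·G ⊔ E·V`, and symmetrically). [cite: Kollar2007, (3.111) Step 3] -/
theorem sup_mul_congr_mod {V E M N F G : R} (hN : N ≤ E) (hFG : F ⊔ V = G ⊔ V) :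
    E * V ⊔ N * F ⊔ M = E * V ⊔ N * G ⊔ M := by
  have key : ∀ {F G : R}, F ⊔ V = G ⊔ V → N * F ≤ E * V ⊔ N * G := by
    intro F G h
    calc N * F ≤ N * (G ⊔ V) := mul_le_mul' le_rfl (le_sup_left.trans h.le)
      _ = N * G ⊔ N * V := by rw [← add_eq_sup, ← add_eq_sup, mul_add]
      _ ≤ N * G ⊔ E * V := sup_le_sup_left (mul_le_mul' hN le_rfl) _
      _ = E * V ⊔ N * G := sup_comm _ _
  refine le_antisymm (sup_le (sup_le (le_sup_left.trans le_sup_left) ((key hFG).trans le_sup_left)) le_sup_right)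
    (sup_le (sup_le (le_sup_left.trans le_sup_left) ((key hFG.symm).trans le_sup_left)) le_sup_right)

/-- **END LIFT, finitely many generators**: `Nⱼ ≤ E` and `Fⱼ ⊔ V = Gⱼ ⊔ V` for `j ∈ s` give
`E·V ⊔ ⨆_{j ∈ s} Nⱼ·Fⱼ ⊔ M = E·V ⊔ ⨆_{j ∈ s} Nⱼ·Gⱼ ⊔ M`. [cite: Kollar2007, (3.111) Step 3] -/
theorem sup_finsetSup_mul_congr_mod {ι : Type*} (s : Finset ι) {V E M : R} {N F G : ι → R}
    (hN : ∀ j ∈ s, N j ≤ E) (hFG : ∀ j ∈ s, F j ⊔ V = G j ⊔ V) :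
    E * V ⊔ s.sup (fun j => N j * F j) ⊔ M = E * V ⊔ s.sup (fun j => N j * G j) ⊔ M := by
  have key : ∀ {F G : ι → R}, (∀ j ∈ s, F j ⊔ V = G j ⊔ V) →
      s.sup (fun j => N j * F j) ≤ E * V ⊔ s.sup (fun j => N j * G j) := by
    intro F G h
    refine Finset.sup_le fun j hj => ?_
    calc N j * F j ≤ N j * (G j ⊔ V) := mul_le_mul' le_rfl (le_sup_left.trans (h j hj).le)
      _ = N j * G j ⊔ N j * V := by rw [← add_eq_sup, ← add_eq_sup, mul_add]
      _ ≤ s.sup (fun j => N j * G j) ⊔ E * V :=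
          sup_le_sup (Finset.le_sup (f := fun j => N j * G j) hj) (mul_le_mul' (hN j hj) le_rfl)
      _ = E * V ⊔ s.sup (fun j => N j * G j) := sup_comm _ _
  refine le_antisymm (sup_le (sup_le (le_sup_left.trans le_sup_left) ((key hFG).trans le_sup_left)) le_sup_right)
    (sup_le (sup_le (le_sup_left.trans le_sup_left) ((key fun j hj => (hFG j hj).symm).trans le_sup_left)) le_sup_right)

/-- **END LIFT, a list of generators** (the cell΄s `List` currency: `⨆` as `foldr (· ⊔ ·) ⊥` over `zipWith`-free index lists). -/
theorem sup_listSup_mul_congr_mod {ι : Type*} (l : List ι) {V E M : R} {N F G : ι → R}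
    (hN : ∀ j ∈ l, N j ≤ E) (hFG : ∀ j ∈ l, F j ⊔ V = G j ⊔ V) :
    E * V ⊔ (l.map fun j => N j * F j).foldr (· ⊔ ·) ⊥ ⊔ M = E * V ⊔ (l.map fun j => N j * G j).foldr (· ⊔ ·) ⊥ ⊔ M := by
  induction l generalizing M with
  | nil => rfl
  | cons j l ih =>
    have hj : N j ≤ E := hN j List.mem_cons_self
    have hjFG : F j ⊔ V = G j ⊔ V := hFG j List.mem_cons_self
    have ih' := ih (M := N j * G j ⊔ M) (fun i hi => hN i (List.mem_cons_of_mem _ hi)) (fun i hi => hFG i (List.mem_cons_of_mem _ hi))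
    simp only [List.map_cons, List.foldr_cons]
    calc E * V ⊔ (N j * F j ⊔ (l.map fun j => N j * F j).foldr (· ⊔ ·) ⊥) ⊔ M
        = E * V ⊔ N j * F j ⊔ ((l.map fun j => N j * F j).foldr (· ⊔ ·) ⊥ ⊔ M) := by ac_rfl
      _ = E * V ⊔ N j * G j ⊔ ((l.map fun j => N j * F j).foldr (· ⊔ ·) ⊥ ⊔ M) := sup_mul_congr_mod hj hjFG
      _ = E * V ⊔ (l.map fun j => N j * F j).foldr (· ⊔ ·) ⊥ ⊔ (N j * G j ⊔ M) := by ac_rfl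
      _ = E * V ⊔ (l.map fun j => N j * G j).foldr (· ⊔ ·) ⊥ ⊔ (N j * G j ⊔ M) := ih'
      _ = E * V ⊔ (N j * G j ⊔ (l.map fun j => N j * G j).foldr (· ⊔ ·) ⊥) ⊔ M := by ac_rfl

end Semiring

/-! ## §2 Elements of a commutative ring: the stalk form -/

section Ring

variable {A : Type*} [CommRing A]

/-- **Cancelling the multiplier modulo the carrier**: if `N·(f − g) ∈ (v)` and `N` is a non-zero-divisor modulo `v` (on the regular carrier
`G = V(v)` the member monomial `N̄` is non-zero in the domain `𝒪_G`), then `f − g ∈ (v)` — this reads the END shape `Fⱼ|_G = N̄ⱼ·ḡⱼ` of a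
generator `Fⱼ = Nⱼ·fⱼ` as `fⱼ ≡ gⱼ (mod v)`. [folklore] -/
theorem sub_mem_span_singleton_of_mul_sub_mem {v N f g : A} (hN : ∀ a : A, N * a ∈ Ideal.span {v} → a ∈ Ideal.span {v})
    (h : N * f - N * g ∈ Ideal.span {v}) : f - g ∈ Ideal.span {v} :=
  hN _ (by rw [mul_sub]; exact h)

/-- **The error term is in the ideal**: `f − g ∈ (v)` and `e ∣ N` give `N·f − N·g ∈ (e·v)`. [cite: Kollar2007, (3.111) Step 3] -/
theorem mul_sub_mul_mem_span_mul {v e N f g : A} (hfg : f - g ∈ Ideal.span {v}) (heN : e ∣ N) :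
    N * f - N * g ∈ Ideal.span ({e * v} : Set A) := by
  obtain ⟨c, rfl⟩ := heN
  obtain ⟨a, ha⟩ := Ideal.mem_span_singleton'.mp hfg
  rw [← mul_sub, ← ha]
  exact Ideal.mem_span_singleton'.mpr ⟨c * a, by ring⟩

/-- Congruence of generators modulo `v` as an equality of ideals. [folklore] -/
theorem span_sup_span_eq_of_sub_mem {v f g : A} (hfg : f - g ∈ Ideal.span {v}) :
    Ideal.span {f} ⊔ Ideal.span {v} = Ideal.span {g} ⊔ Ideal.span ({v} : Set A) := by
  have key : ∀ {f g : A}, f - g ∈ Ideal.span {v} → Ideal.span {f} ≤ Ideal.span {g} ⊔ Ideal.span ({v} : Set A) := by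
    intro f g h
    rw [Ideal.span_singleton_le_iff_mem]
    have hf : f = g + (f - g) := by ring
    rw [hf]
    exact Ideal.add_mem _ (Ideal.mem_sup_left (Ideal.mem_span_singleton_self g)) (Ideal.mem_sup_right h)
  refine le_antisymm (sup_le (key hfg) le_sup_right) (sup_le (key ?_) le_sup_right)
  rw [← neg_sub]
  exact (Ideal.span {v}).neg_mem hfg

/-- **END LIFT, stalk form**: `f − g ∈ (v)` and `e ∣ N` give `(e v) + (N f) + J = (e v) + (N g) + J`. [cite: Kollar2007, (3.111) Step 3] -/
theorem span_sup_span_mul_congr_mod {v e N f g : A} (J : Ideal A) (hfg : f - g ∈ Ideal.span {v}) (heN : e ∣ N) :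
    Ideal.span {e * v} ⊔ Ideal.span {N * f} ⊔ J = Ideal.span {e * v} ⊔ Ideal.span ({N * g} : Set A) ⊔ J := by
  have h1 : Ideal.span ({e * v} : Set A) = Ideal.span {e} * Ideal.span {v} := by rw [Ideal.span_singleton_mul_span_singleton]
  have h2 : ∀ x : A, Ideal.span ({N * x} : Set A) = Ideal.span {N} * Ideal.span {x} := fun x => by
    rw [Ideal.span_singleton_mul_span_singleton]
  rw [h1, h2, h2]
  exact sup_mul_congr_mod (Ideal.span_singleton_le_span_singleton.mpr heN) (span_sup_span_eq_of_sub_mem hfg)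

end Ring

/-! ## §3 Ideal sheaves: the patch form -/

section Sheaf

variable {X : Scheme.{u}}

/-- **END LIFT on the patch, one generator**: for ideal sheaves with `N ≤ E` (the multiplier΄s exceptional content dominates `e`) and
`F ⊔ V = G ⊔ V` (the sections agree on the carrier `V(V)`): `E·V ⊔ N·F ⊔ 𝓜 = E·V ⊔ N·G ⊔ 𝓜`. [cite: Kollar2007, (3.111) Step 3] -/
theorem idealSheaf_sup_mul_congr_mod {V E M N F G : X.IdealSheafData} (hN : N ≤ E) (hFG : F ⊔ V = G ⊔ V) :
    E * V ⊔ N * F ⊔ M = E * V ⊔ N * G ⊔ M :=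
  sup_mul_congr_mod hN hFG

/-- **END LIFT on the patch, finitely many generators**: `K^{tot} = (e·v) ⊔ ⨆ⱼ 𝓜(Nⱼ)·Fⱼ ⊔ 𝓜(μ) = (e·v) ⊔ ⨆ⱼ 𝓜(Nⱼ)·Gⱼ ⊔ 𝓜(μ)` for
`Fⱼ ≡ Gⱼ` modulo the carrier ideal and `𝓜(Nⱼ) ≤ (e)`. [cite: Kollar2007, (3.111) Step 3] -/
theorem idealSheaf_sup_finsetSup_mul_congr_mod {ι : Type*} (s : Finset ι) {V E M : X.IdealSheafData} {N F G : ι → X.IdealSheafData}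
    (hN : ∀ j ∈ s, N j ≤ E) (hFG : ∀ j ∈ s, F j ⊔ V = G j ⊔ V) :
    E * V ⊔ s.sup (fun j => N j * F j) ⊔ M = E * V ⊔ s.sup (fun j => N j * G j) ⊔ M :=
  sup_finsetSup_mul_congr_mod s hN hFG

/-- The same over a `List` of generators. [cite: Kollar2007, (3.111) Step 3] -/
theorem idealSheaf_sup_listSup_mul_congr_mod {ι : Type*} (l : List ι) {V E M : X.IdealSheafData} {N F G : ι → X.IdealSheafData}
    (hN : ∀ j ∈ l, N j ≤ E) (hFG : ∀ j ∈ l, F j ⊔ V = G j ⊔ V) :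
    E * V ⊔ (l.map fun j => N j * F j).foldr (· ⊔ ·) ⊥ ⊔ M = E * V ⊔ (l.map fun j => N j * G j).foldr (· ⊔ ·) ⊥ ⊔ M :=
  sup_listSup_mul_congr_mod l hN hFG

end Sheaf

end ContactEndLift

end Summit.ResolutionOfSingularities.ResolutionOfSingularities.Theorems

end
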